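import Mathlib
import Summits.PneNP.PneNP.Theorems.ChebyshevTracialDesignHalfDegree
import HarnessLib

/-!
# Half-degree lemma, part D: the explicit monomial law and type invariance

Support file for the crux `TracialDecayExp20` (stmt-PneNP-19878) of route `ChebyshevTracialDesign`
(cell pnp-psdrank; eng MEMO-6 §2 «dipole route to the attenuation estimate (ATT)»).

The computation of `ChebyshevTracialDesignHalfDegree` made explicit: for a perfect matching `M` of `S` with `N`
edges and `A ⊆ S` meeting `x` edges of `M`, `j₁` of them in exactly one vertex,
`Σ_{U ⊆ S : #cr(U,M) = c, #in(U,M) = i} 1[A ⊆ U] = T(N;c,i) · [N]_x⁻¹ · Σ_{m ≤ j₁} C(j₁,m)·2^{-m}·[c]_m·[i]_{x−m}`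
(`level_sum_superset_eq_type`; `[z]_m = ∏_{j<m}(z − j)`), so the level sums of a monomial `x_A` depend on `A`
only through its incidence TYPE `(x, j₁)` against `M` (`level_sum_superset_eq_of_type`). This is the fact that
makes the `k`-dipole products `∏_i (1[a_i ∈ U] − 1[b_i ∈ U])` average to `0` over every level class of `M`
unless every dipole `{a_i, b_i}` has an endpoint matched by `M` inside the `2k` dipole points (swap `a_i ↔ b_i`
in the monomial expansion: same type), the input of the uniform-in-`c` attenuation bound
`σ_k(c)² ≤ P[all dipoles internally hit]/‖φ_k‖² = (Ck/n)^{k/2}` (eng MEMO-6; kit j252893 checks both exactly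
for n ≤ 12).
WHAT THIS IS NOT: the dipole-vanishing statement itself and the Johnson-scheme facts (dipole products span the
mode `(n−k,k)`; class-function kernels act as scalars) are not in this file. No definitions.
-/

set_option linter.dupNamespace false -- `Summit.PneNP.PneNP.…`: summit = sub-problem (D-0017)

namespace Summit.PneNP.PneNP.Theorems.ChebyshevTracialDesignHalfDegree

open Finset Polynomial

section TypeInvariance

open Literature.Barriers.PneNP Summit.PneNP.PneNP.Theorems.ChebyshevTracialDesignJunta

variable {V : Type*} [DecidableEq V]

/-- **Level sums of a monomial as an evaluated placement sum**: for a perfect matching `M` of `S`, `A ⊆ S` with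
window `E`, and every `(c, i)`,
`Σ_{U ⊆ S : #cr = c, #in = i} 1[A ⊆ U] = T(|M|;c,i) · [|M|]_{|E|}⁻¹ · Σ_{Q ⊆ E} (∏_{E\Q} κ)·[c]_{|E\Q|}·[i]_{|Q|}`
(`κ_e = 1/2` if `|A ∩ e| = 1`, else `0`). This is the computation inside `half_degree_monomial`, recorded as an
identity (no `t`, no polynomial). [folklore] -/
theorem level_sum_superset_eq_placement {S A : Finset V} {M : Finset (Sym2 V)} (hM : IsPMOn S M) (hA : A ⊆ S)
    (c i : ℕ) :
    ∑ U ∈ S.powerset.filter (fun U => (M.filter fun e => cutCount U e = 1).card = c ∧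
        (M.filter fun e => cutCount U e = 2).card = i), (if A ⊆ U then (1 : ℝ) else 0) =
      ((M.card.choose (c + i) * (c + i).choose i * 2 ^ c : ℕ) : ℝ) *
        (((M.card.descFactorial (M.filter fun e => cutCount A e ≠ 0).card : ℝ)⁻¹) *
          ∑ Q ∈ (M.filter fun e => cutCount A e ≠ 0).powerset,
            (∏ e ∈ (M.filter fun e => cutCount A e ≠ 0) \ Q, (if cutCount A e = 1 then (1 / 2 : ℝ) else 0)) *
              ((∏ j ∈ range ((M.filter fun e => cutCount A e ≠ 0) \ Q).card, ((c : ℝ) - j)) *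
                ∏ j ∈ range Q.card, ((i : ℝ) - j))) := by
  classical
  have hEM : (M.filter fun e => cutCount A e ≠ 0) ⊆ M := filter_subset _ _
  have hxN : (M.filter fun e => cutCount A e ≠ 0).card ≤ M.card := card_le_card hEM
  have hAW := subset_window hM hA
  rw [← sum_fiberwise_of_maps_to (g := fun U => U ∩ S.filter fun v =>
      ∃ e ∈ M.filter (fun e => cutCount A e ≠ 0), v ∈ e)
    (t := (S.filter fun v => ∃ e ∈ M.filter (fun e => cutCount A e ≠ 0), v ∈ e).powerset)
    (fun U _ => mem_powerset.2 inter_subset_right)]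
  have hfib : ∀ B ∈ (S.filter fun v => ∃ e ∈ M.filter (fun e => cutCount A e ≠ 0), v ∈ e).powerset,
      ∑ U ∈ (S.powerset.filter fun U => (M.filter fun e => cutCount U e = 1).card = c ∧
          (M.filter fun e => cutCount U e = 2).card = i).filter
          (fun U => U ∩ (S.filter fun v => ∃ e ∈ M.filter (fun e => cutCount A e ≠ 0), v ∈ e) = B),
        (if A ⊆ U then (1 : ℝ) else 0) =
      if A ⊆ B then
        (((if ((M.filter fun e => cutCount A e ≠ 0).filter fun e => cutCount B e = 1).card ≤ c ∧
              ((M.filter fun e => cutCount A e ≠ 0).filter fun e => cutCount B e = 2).card ≤ i then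
          (M.card - (M.filter fun e => cutCount A e ≠ 0).card).choose
              (c - ((M.filter fun e => cutCount A e ≠ 0).filter fun e => cutCount B e = 1).card +
                (i - ((M.filter fun e => cutCount A e ≠ 0).filter fun e => cutCount B e = 2).card)) *
            (c - ((M.filter fun e => cutCount A e ≠ 0).filter fun e => cutCount B e = 1).card +
              (i - ((M.filter fun e => cutCount A e ≠ 0).filter fun e => cutCount B e = 2).card)).choose
                (i - ((M.filter fun e => cutCount A e ≠ 0).filter fun e => cutCount B e = 2).card) *
            2 ^ (c - ((M.filter fun e => cutCount A e ≠ 0).filter fun e => cutCount B e = 1).card)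
          else 0 : ℕ)) : ℝ)
      else 0 := by
    intro B hB
    have hconst : ∀ U ∈ (S.powerset.filter fun U => (M.filter fun e => cutCount U e = 1).card = c ∧
        (M.filter fun e => cutCount U e = 2).card = i).filter
        (fun U => U ∩ (S.filter fun v => ∃ e ∈ M.filter (fun e => cutCount A e ≠ 0), v ∈ e) = B),
        (if A ⊆ U then (1 : ℝ) else 0) = if A ⊆ B then (1 : ℝ) else 0 := by
      intro U hU
      have hUW := (mem_filter.1 hU).2
      have hiff : A ⊆ U ↔ A ⊆ B := by
        rw [← hUW]
        exact ⟨fun h => subset_inter h hAW, fun h => h.trans inter_subset_left⟩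
      by_cases hAB : A ⊆ B
      · rw [if_pos hAB, if_pos (hiff.2 hAB)]
      · rw [if_neg hAB, if_neg (fun h => hAB (hiff.1 h))]
    rw [sum_congr rfl hconst, sum_const, nsmul_eq_mul, filter_filter]
    have hfibB := card_fiber_eq hM hEM (mem_powerset.1 hB) c i
    have hset : (S.powerset.filter fun U => ((M.filter fun e => cutCount U e = 1).card = c ∧
          (M.filter fun e => cutCount U e = 2).card = i) ∧
          U ∩ (S.filter fun v => ∃ e ∈ M.filter (fun e => cutCount A e ≠ 0), v ∈ e) = B) =
        S.powerset.filter fun U => (M.filter fun e => cutCount U e = 1).card = c ∧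
          (M.filter fun e => cutCount U e = 2).card = i ∧
          U ∩ (S.filter fun v => ∃ e ∈ M.filter (fun e => cutCount A e ≠ 0), v ∈ e) = B :=
      filter_congr fun U _ => and_assoc
    rw [hset, hfibB]
    by_cases hAB : A ⊆ B
    · rw [if_pos hAB, if_pos hAB, mul_one]
    · rw [if_neg hAB, if_neg hAB, mul_zero]
  rw [sum_congr rfl hfib, ← sum_filter]
  have hratio : ∀ B ∈ (S.filter fun v => ∃ e ∈ M.filter (fun e => cutCount A e ≠ 0), v ∈ e).powerset.filter
      (fun B => A ⊆ B),
      (((if ((M.filter fun e => cutCount A e ≠ 0).filter fun e => cutCount B e = 1).card ≤ c ∧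
              ((M.filter fun e => cutCount A e ≠ 0).filter fun e => cutCount B e = 2).card ≤ i then
          (M.card - (M.filter fun e => cutCount A e ≠ 0).card).choose
              (c - ((M.filter fun e => cutCount A e ≠ 0).filter fun e => cutCount B e = 1).card +
                (i - ((M.filter fun e => cutCount A e ≠ 0).filter fun e => cutCount B e = 2).card)) *
            (c - ((M.filter fun e => cutCount A e ≠ 0).filter fun e => cutCount B e = 1).card +
              (i - ((M.filter fun e => cutCount A e ≠ 0).filter fun e => cutCount B e = 2).card)).choose
                (i - ((M.filter fun e => cutCount A e ≠ 0).filter fun e => cutCount B e = 2).card) *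
            2 ^ (c - ((M.filter fun e => cutCount A e ≠ 0).filter fun e => cutCount B e = 1).card)
          else 0 : ℕ)) : ℝ) =
        ((M.card.choose (c + i) * (c + i).choose i * 2 ^ c : ℕ) : ℝ) *
          (((M.card.descFactorial (M.filter fun e => cutCount A e ≠ 0).card : ℝ)⁻¹) *
            ((1 / 2 : ℝ) ^ ((M.filter fun e => cutCount A e ≠ 0).filter fun e => cutCount B e = 1).card *
              ((∏ j ∈ range ((M.filter fun e => cutCount A e ≠ 0).filter fun e => cutCount B e = 1).card,
                  ((c : ℝ) - j)) *
                ∏ j ∈ range ((M.filter fun e => cutCount A e ≠ 0).filter fun e => cutCount B e = 2).card,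
                  ((i : ℝ) - j)))) := by
    intro B hB
    rw [mem_filter, mem_powerset] at hB
    rw [fibre_ratio hxN (card_cr_add_card_in_window (M := M) hB.2) c i, one_div, inv_pow]
    have h2 : (2 : ℝ) ^ ((M.filter fun e => cutCount A e ≠ 0).filter fun e => cutCount B e = 1).card ≠ 0 :=
      pow_ne_zero _ two_ne_zero
    have hN : (M.card.descFactorial (M.filter fun e => cutCount A e ≠ 0).card : ℝ) ≠ 0 := by
      have : M.card.descFactorial (M.filter fun e => cutCount A e ≠ 0).card ≠ 0 := fun h0 => by
        rw [Nat.descFactorial_eq_zero_iff_lt] at h0; omega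
      exact_mod_cast this
    field_simp
  rw [sum_congr rfl hratio, ← mul_sum, ← mul_sum,
    sum_traces_eq_sum_placements hM hA
      (fun y z => (∏ j ∈ range y, ((c : ℝ) - j)) * ∏ j ∈ range z, ((i : ℝ) - j))]

/-- A placement sum with indicator values `κ_e ∈ {1/2, 0}` only depends on the number `j₁` of atoms with
`κ = 1/2`: `Σ_{Q ⊆ E} (∏_{E\Q} κ)·F(|E\Q|, |Q|) = Σ_{m ≤ j₁} C(j₁,m)·2^{-m}·F(m, |E| − m)`. [folklore] -/
theorem sum_placements_eq_sum_choose {β : Type*} [DecidableEq β] (E : Finset β) (p : β → Prop)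
    [DecidablePred p] (F : ℕ → ℕ → ℝ) :
    ∑ Q ∈ E.powerset, (∏ e ∈ E \ Q, (if p e then (1 / 2 : ℝ) else 0)) * F (E \ Q).card Q.card =
      ∑ m ∈ range ((E.filter p).card + 1),
        ((E.filter p).card.choose m : ℝ) * ((1 / 2 : ℝ) ^ m * F m (E.card - m)) := by
  -- reindex by the complement `P = E \ Q`
  have hre : ∑ Q ∈ E.powerset, (∏ e ∈ E \ Q, (if p e then (1 / 2 : ℝ) else 0)) * F (E \ Q).card Q.card =
      ∑ P ∈ E.powerset, (∏ e ∈ P, (if p e then (1 / 2 : ℝ) else 0)) * F P.card (E.card - P.card) := by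
    refine sum_nbij' (fun Q => E \ Q) (fun P => E \ P) (fun Q _ => mem_powerset.2 sdiff_subset)
      (fun P _ => mem_powerset.2 sdiff_subset) (fun Q hQ => ?_) (fun P hP => ?_) (fun Q hQ => ?_)
    · exact Finset.sdiff_sdiff_eq_self (mem_powerset.1 hQ)
    · exact Finset.sdiff_sdiff_eq_self (mem_powerset.1 hP)
    · rw [mem_powerset] at hQ
      rw [card_sdiff_of_subset hQ, Nat.sub_sub_self (card_le_card hQ)]
  rw [hre]
  -- placements `P ⊄ E.filter p` vanish; the rest is a sum over `(E.filter p).powerset` by cardinality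
  rw [← sum_filter_of_ne (p := fun P => P ⊆ E.filter p) (fun P hP hne => ?_)]
  swap
  · by_contra hsub
    obtain ⟨e, heP, he⟩ := not_subset.1 hsub
    have hpe : ¬p e := fun h => he (mem_filter.2 ⟨mem_powerset.1 hP heP, h⟩)
    exact hne (by rw [prod_eq_zero heP (if_neg hpe), zero_mul])
  have hset : (E.powerset.filter fun P => P ⊆ E.filter p) = (E.filter p).powerset := by
    ext P
    simp only [mem_filter, mem_powerset]
    exact ⟨fun h => h.2, fun h => ⟨h.trans (filter_subset _ _), h⟩⟩
  rw [hset]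
  have hterm : ∀ P ∈ (E.filter p).powerset, (∏ e ∈ P, (if p e then (1 / 2 : ℝ) else 0)) *
      F P.card (E.card - P.card) = (1 / 2 : ℝ) ^ P.card * F P.card (E.card - P.card) := by
    intro P hP
    rw [prod_congr rfl fun e he => if_pos (mem_filter.1 (mem_powerset.1 hP he)).2, prod_const]
  rw [sum_congr rfl hterm, sum_powerset_apply_card (fun m => (1 / 2 : ℝ) ^ m * F m (E.card - m))]
  refine sum_congr rfl fun m _ => ?_
  rw [nsmul_eq_mul]

/-- **Explicit monomial law / type invariance**: for a perfect matching `M` of `S` (`N` edges) and `A ⊆ S`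
meeting `x` edges of `M`, `j₁` of them in exactly one vertex,
`Σ_{U ⊆ S : #cr = c, #in = i} 1[A ⊆ U] = T(N;c,i) · [N]_x⁻¹ · Σ_{m ≤ j₁} C(j₁,m) 2^{-m} [c]_m [i]_{x−m}` —
the level sums of the monomial `x_A` depend on `A` only through its TYPE `(x, j₁)` against `M`
(equivalently `(j₁, j₂)`, `x = j₁ + j₂`, `|A| = j₁ + 2j₂`). This is the input «E[x_A | cc = c] is a class
function of the incidence type» behind the dipole-vanishing step of the attenuation estimate (cell pnp-psdrank,
eng MEMO-6 §2). [folklore] -/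
theorem level_sum_superset_eq_type {S A : Finset V} {M : Finset (Sym2 V)} (hM : IsPMOn S M) (hA : A ⊆ S)
    (c i : ℕ) :
    ∑ U ∈ S.powerset.filter (fun U => (M.filter fun e => cutCount U e = 1).card = c ∧
        (M.filter fun e => cutCount U e = 2).card = i), (if A ⊆ U then (1 : ℝ) else 0) =
      ((M.card.choose (c + i) * (c + i).choose i * 2 ^ c : ℕ) : ℝ) *
        (((M.card.descFactorial (M.filter fun e => cutCount A e ≠ 0).card : ℝ)⁻¹) *
          ∑ m ∈ range (((M.filter fun e => cutCount A e ≠ 0).filter fun e => cutCount A e = 1).card + 1),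
            ((((M.filter fun e => cutCount A e ≠ 0).filter fun e => cutCount A e = 1).card.choose m : ℕ) : ℝ) *
              ((1 / 2 : ℝ) ^ m * ((∏ j ∈ range m, ((c : ℝ) - j)) *
                ∏ j ∈ range ((M.filter fun e => cutCount A e ≠ 0).card - m), ((i : ℝ) - j)))) := by
  rw [level_sum_superset_eq_placement hM hA c i,
    sum_placements_eq_sum_choose _ (fun e => cutCount A e = 1)
      (fun y z => (∏ j ∈ range y, ((c : ℝ) - j)) * ∏ j ∈ range z, ((i : ℝ) - j))]

/-- **Type invariance** (corollary): two vertex sets `A, A' ⊆ S` meeting the same number of edges of the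
perfect matching `M`, and the same number of them exactly once, have the same level sums
`Σ_{U : #cr = c, #in = i} 1[A ⊆ U] = Σ_{U : #cr = c, #in = i} 1[A' ⊆ U]` for every `(c, i)`. [folklore] -/
theorem level_sum_superset_eq_of_type {S A A' : Finset V} {M : Finset (Sym2 V)} (hM : IsPMOn S M)
    (hA : A ⊆ S) (hA' : A' ⊆ S)
    (hx : (M.filter fun e => cutCount A e ≠ 0).card = (M.filter fun e => cutCount A' e ≠ 0).card)
    (h1 : ((M.filter fun e => cutCount A e ≠ 0).filter fun e => cutCount A e = 1).card =
      ((M.filter fun e => cutCount A' e ≠ 0).filter fun e => cutCount A' e = 1).card) (c i : ℕ) :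
    ∑ U ∈ S.powerset.filter (fun U => (M.filter fun e => cutCount U e = 1).card = c ∧
        (M.filter fun e => cutCount U e = 2).card = i), (if A ⊆ U then (1 : ℝ) else 0) =
      ∑ U ∈ S.powerset.filter (fun U => (M.filter fun e => cutCount U e = 1).card = c ∧
        (M.filter fun e => cutCount U e = 2).card = i), (if A' ⊆ U then (1 : ℝ) else 0) := by
  rw [level_sum_superset_eq_type hM hA, level_sum_superset_eq_type hM hA', hx, h1]

end TypeInvariance

end Summit.PneNP.PneNP.Theorems.ChebyshevTracialDesignHalfDegree
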